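import Mathlib

/-!
# Crux `SignCone.ConeMagnification` (stmt-RiemannHypothesis-16303), line `Sketch` r8, stub `stub_designOfTypes`:
# the gcd form of a block design factorises over the primes

Route `RiemannHypothesis/SignCone`, crux `ConeMagnification`, line `Sketch` (skeleton r8, lead
`prover-line-stmt-RiemannHypothesis-16303-c1`), seat-0 programme "second-order design algebra" for the open core
`stub_designOfTypes` (the type inequalities for all finitely supported complex designs `α` imply the 2001 design
data AX-A/AX-B/AX-C).  The type inequality of the skeleton is phrased with the [CV] gcd form

  `Φ_α(n) = Σ_{ℓ,ℓ' ≤ L} α_ℓ conj(α_ℓ') gcd(n ℓ', ℓ)/√(ℓ ℓ')`.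

This file proves the one structural fact about it that the whole programme rests on: for a BLOCK DESIGN on a finite
set `S` of primes — exponent vectors `x : S → {0,1,2}`, monomials `ℓ(x) = Π_{p∈S} p^{x_p}`, coefficients
`Π_{p∈S} f_p(x_p)`, and `α_ℓ = Σ_{x : ℓ(x) = ℓ} Π_p f_p(x_p)` — the gcd form is the product over `p ∈ S` of the
single-prime `3 × 3` forms

  `Φ_α(n) = Π_{p∈S} Σ_{i,j ≤ 2} f_p(i) conj(f_p(j)) p^{min(i, j + v_p(n))} / √(p^i p^j)`      (`n ≥ 1`),

because `gcd(n ℓ(y), ℓ(x))` and `√(ℓ(x) ℓ(y))` are multiplicative in the prime (`gcd_mul_prod_pow_prod_pow`) and a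
double sum of products over exponent vectors is a product of double sums (`Finset.prod_univ_sum`).  Main results:
`gcd_mul_prod_pow_prod_pow`, `blockDesign_eq_zero_of_lt` (support), `gcdForm_blockDesign` (factorisation).
No definitions: the design is handed in through a characterising hypothesis `hα`.
-/

noncomputable section

-- `Summit.RiemannHypothesis.RiemannHypothesis.…` repeats a namespace component by design (D-0017 layout).
set_option linter.dupNamespace false

open Finset
open scoped BigOperators ComplexConjugate

namespace Summit.RiemannHypothesis.RiemannHypothesis.Theorems.SignConeConeMagnification

namespace Design

/-! ### gcd of prime-power products -/

/-- `gcd(m, q^i) = q^{min(v_q(m), i)}` for a prime `q` and `m ≠ 0`. [folklore] -/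
theorem gcd_prime_pow_right {q m : ℕ} (hq : q.Prime) (hm : m ≠ 0) (i : ℕ) :
    Nat.gcd m (q ^ i) = q ^ min (m.factorization q) i := by
  have h1 : Nat.gcd m (q ^ i) ∣ q ^ i := Nat.gcd_dvd_right _ _
  obtain ⟨k, -, hkeq⟩ := (Nat.dvd_prime_pow hq).1 h1
  rw [hkeq]
  congr 1
  have h2 : (Nat.gcd m (q ^ i)).factorization q = min (m.factorization q) i := by
    rw [Nat.factorization_gcd hm (pow_ne_zero _ hq.ne_zero)]
    simp [hq.factorization_pow]
  rw [hkeq] at h2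
  simpa [hq.factorization_pow] using h2

/-- For a finite set `S` of primes and exponents `x, y`:
`gcd(n · Π_{p∈S} p^{y_p}, Π_{p∈S} p^{x_p}) = Π_{p∈S} p^{min(x_p, y_p + v_p(n))}` (`n ≠ 0`). [folklore] -/
theorem gcd_mul_prod_pow_prod_pow (S : Finset ℕ) (hS : ∀ p ∈ S, p.Prime) (x y : ℕ → ℕ) (n : ℕ)
    (hn : n ≠ 0) :
    Nat.gcd (n * ∏ p ∈ S, p ^ y p) (∏ p ∈ S, p ^ x p) =
      ∏ p ∈ S, p ^ min (x p) (y p + n.factorization p) := by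
  classical
  induction S using Finset.induction_on with
  | empty => simp
  | insert q S hq ih =>
    have hS' : ∀ p ∈ S, p.Prime := fun p hp => hS p (mem_insert_of_mem hp)
    have hqp : q.Prime := hS q (mem_insert_self q S)
    have hcop : ∀ (a : ℕ) (z : ℕ → ℕ), Nat.Coprime (q ^ a) (∏ p ∈ S, p ^ z p) := by
      intro a z
      refine Nat.coprime_prod_right_iff.mpr fun p hp => ?_
      have hpq : q ≠ p := fun h => hq (h ▸ hp)
      exact Nat.coprime_pow_primes a (z p) hqp (hS' p hp) hpq
    have hPne : ∀ z : ℕ → ℕ, (∏ p ∈ S, p ^ z p) ≠ 0 := fun z =>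
      prod_ne_zero_iff.mpr fun p hp => pow_ne_zero _ (hS' p hp).ne_zero
    rw [prod_insert hq, prod_insert hq, prod_insert hq, Nat.Coprime.gcd_mul _ (hcop (x q) x)]
    congr 1
    · -- the prime `q`
      have hne : n * (q ^ y q * ∏ p ∈ S, p ^ y p) ≠ 0 :=
        mul_ne_zero hn (mul_ne_zero (pow_ne_zero _ hqp.ne_zero) (hPne y))
      rw [gcd_prime_pow_right hqp hne, Nat.factorization_mul hn (mul_ne_zero (pow_ne_zero _ hqp.ne_zero)
        (hPne y)), Nat.factorization_mul (pow_ne_zero _ hqp.ne_zero) (hPne y)]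
      have hv0 : (∏ p ∈ S, p ^ y p).factorization q = 0 := by
        apply Nat.factorization_eq_zero_of_not_dvd
        have := (Nat.Prime.coprime_iff_not_dvd hqp).1 (by simpa using hcop 1 y)
        exact this
      simp only [Finsupp.coe_add, Pi.add_apply, hqp.factorization_pow, Finsupp.single_eq_same, hv0,
        add_zero]
      rw [min_comm, add_comm]
    · -- the primes of `S`
      have : n * (q ^ y q * ∏ p ∈ S, p ^ y p) = (n * ∏ p ∈ S, p ^ y p) * q ^ y q := by ring
      rw [this, Nat.Coprime.gcd_mul_right_cancel _ (hcop (y q) x)]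
      exact ih hS'

/-! ### Products over the subtype `↥S` versus over `S` -/

/-- A product over the type `↥S` written as a product over the finset `S` of the extension-by-one. [folklore] -/
theorem prod_coe_sort_dite {M : Type*} [CommMonoid M] (S : Finset ℕ) (g : S → M) :
    ∏ i : S, g i = ∏ p ∈ S, (if h : p ∈ S then g ⟨p, h⟩ else 1) := by
  rw [← Finset.prod_coe_sort S]
  refine Finset.prod_congr rfl fun i _ => ?_
  rw [dif_pos i.2]

/-- The monomial of an exponent vector on `↥S` as a product over `S` of the extension-by-zero exponents. [folklore] -/
theorem mono_eq_prod_dite (S : Finset ℕ) (x : S → ℕ) :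
    (∏ i : S, (i : ℕ) ^ x i) = ∏ p ∈ S, p ^ (if h : p ∈ S then x ⟨p, h⟩ else 0) := by
  rw [prod_coe_sort_dite]
  refine Finset.prod_congr rfl fun p hp => ?_
  rw [dif_pos hp, dif_pos hp]

/-- The gcd of `n` times one monomial with another monomial on the same prime set, as a product over `↥S`. [folklore] -/
theorem gcd_mul_mono_mono (S : Finset ℕ) (hS : ∀ p ∈ S, p.Prime) (x y : S → ℕ) (n : ℕ) (hn : n ≠ 0) :
    Nat.gcd (n * ∏ i : S, (i : ℕ) ^ y i) (∏ i : S, (i : ℕ) ^ x i) =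
      ∏ i : S, (i : ℕ) ^ min (x i) (y i + n.factorization i) := by
  rw [mono_eq_prod_dite, mono_eq_prod_dite, gcd_mul_prod_pow_prod_pow S hS _ _ n hn, prod_coe_sort_dite]
  refine Finset.prod_congr rfl fun p hp => ?_
  simp only [dif_pos hp]

/-- Monomials of exponent vectors with entries `≤ 2` lie in `[1, L]` once `Π_{p∈S} p² ≤ L`. [folklore] -/
theorem mono_mem_Icc (S : Finset ℕ) (hS : ∀ p ∈ S, p.Prime) (L : ℕ) (hL : ∏ p ∈ S, p ^ 2 ≤ L)
    (x : S → ℕ) (hx : x ∈ Fintype.piFinset fun _ : S => Finset.range 3) :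
    (∏ i : S, (i : ℕ) ^ x i) ∈ Finset.Icc 1 L := by
  rw [Finset.mem_Icc]
  constructor
  · rw [Nat.one_le_iff_ne_zero]
    exact prod_ne_zero_iff.mpr fun i _ => pow_ne_zero _ (hS i i.2).ne_zero
  · refine le_trans ?_ hL
    rw [← Finset.prod_coe_sort S (fun p => p ^ 2)]
    apply Finset.prod_le_prod' fun i _ => ?_
    have hxi : x i < 3 := by
      have := Fintype.mem_piFinset.1 hx i
      simpa using this
    exact Nat.pow_le_pow_right (hS i i.2).pos (by omega)

/-! ### The block design and its support -/

/-- A block design (given through its characterising hypothesis `hα`) vanishes above `L ≥ Π_{p∈S} p²`. [folklore] -/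
theorem blockDesign_eq_zero_of_lt (S : Finset ℕ) (hS : ∀ p ∈ S, p.Prime) (f : ℕ → ℕ → ℂ) (α : ℕ → ℂ)
    (hα : ∀ ℓ, α ℓ = ∑ x ∈ (Fintype.piFinset fun _ : S => Finset.range 3) with
      (∏ i : S, (i : ℕ) ^ x i) = ℓ, ∏ i : S, f i (x i))
    (L : ℕ) (hL : ∏ p ∈ S, p ^ 2 ≤ L) : ∀ m, L < m → α m = 0 := by
  intro m hm
  rw [hα]
  apply Finset.sum_eq_zero
  intro x hx
  exfalso
  rw [Finset.mem_filter] at hx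
  have := (Finset.mem_Icc.1 (mono_mem_Icc S hS L hL x hx.1)).2
  omega

/-! ### The factorisation of the gcd form -/

/-- Collapsing two fibre sums: `Σ_{ℓ,ℓ'} (Σ_{x:μx=ℓ} a_x)(Σ_{y:μy=ℓ'} b_y) K(ℓ,ℓ') = Σ_{x,y} a_x b_y K(μx, μy)`. [folklore] -/
theorem sum_fiber_mul_sum_fiber {ι : Type*} [DecidableEq ι] (E : Finset ι) (μ : ι → ℕ) (t : Finset ℕ)
    (hmaps : ∀ x ∈ E, μ x ∈ t) (a b : ι → ℂ) (K : ℕ → ℕ → ℂ) :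
    (∑ ℓ ∈ t, ∑ ℓ' ∈ t, (∑ x ∈ E with μ x = ℓ, a x) * (∑ y ∈ E with μ y = ℓ', b y) * K ℓ ℓ') =
      ∑ x ∈ E, ∑ y ∈ E, a x * b y * K (μ x) (μ y) := by
  have h1 : ∀ ℓ ℓ', (∑ x ∈ E with μ x = ℓ, a x) * (∑ y ∈ E with μ y = ℓ', b y) * K ℓ ℓ' =
      ∑ x ∈ E with μ x = ℓ, ∑ y ∈ E with μ y = ℓ', a x * b y * K (μ x) (μ y) := by
    intro ℓ ℓ'
    rw [Finset.sum_mul, Finset.sum_mul]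
    refine Finset.sum_congr rfl fun x hx => ?_
    rw [Finset.mul_sum, Finset.sum_mul]
    refine Finset.sum_congr rfl fun y hy => ?_
    rw [(Finset.mem_filter.1 hx).2, (Finset.mem_filter.1 hy).2]
  simp_rw [h1]
  have h2 : ∀ ℓ, (∑ ℓ' ∈ t, ∑ x ∈ E with μ x = ℓ, ∑ y ∈ E with μ y = ℓ', a x * b y * K (μ x) (μ y)) =
      ∑ x ∈ E with μ x = ℓ, ∑ y ∈ E, a x * b y * K (μ x) (μ y) := by
    intro ℓ
    rw [Finset.sum_comm]
    refine Finset.sum_congr rfl fun x _ => ?_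
    exact Finset.sum_fiberwise_of_maps_to hmaps _
  simp_rw [h2]
  exact Finset.sum_fiberwise_of_maps_to hmaps _

/-- The single summand of the gcd form on a pair of monomials factorises over the primes of `S`. [folklore] -/
theorem gcdKernel_mono_mono (S : Finset ℕ) (hS : ∀ p ∈ S, p.Prime) (x y : S → ℕ) (n : ℕ) (hn : n ≠ 0) :
    (((Nat.gcd (n * ∏ i : S, (i : ℕ) ^ y i) (∏ i : S, (i : ℕ) ^ x i) : ℕ) : ℝ) : ℂ) /
        (Real.sqrt (((∏ i : S, (i : ℕ) ^ x i : ℕ) : ℝ) * ((∏ i : S, (i : ℕ) ^ y i : ℕ) : ℝ)) : ℂ) =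
      ∏ i : S, (((i : ℕ) : ℂ) ^ min (x i) (y i + n.factorization i) /
        (Real.sqrt (((i : ℕ) : ℝ) ^ x i * ((i : ℕ) : ℝ) ^ y i) : ℂ)) := by
  rw [gcd_mul_mono_mono S hS x y n hn, Finset.prod_div_distrib]
  congr 1
  · push_cast
    rfl
  · have h1 : (((∏ i : S, (i : ℕ) ^ x i : ℕ) : ℝ) * ((∏ i : S, (i : ℕ) ^ y i : ℕ) : ℝ)) =
        ∏ i : S, (((i : ℕ) : ℝ) ^ x i * ((i : ℕ) : ℝ) ^ y i) := by
      push_cast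
      rw [← Finset.prod_mul_distrib]
    rw [h1, Real.sqrt_prod _ fun i _ => by positivity]
    push_cast
    rfl

/-- **The gcd form of a block design factorises over the primes** (seat-0, design algebra §1).
For a finite set `S` of primes, blocks `f p : ℕ → ℂ` (only the values at `0, 1, 2` matter) and the block design
`α_ℓ = Σ_{x : S → {0,1,2}, Π p^{x_p} = ℓ} Π_p f_p(x_p)`, for every `L ≥ Π_{p∈S} p²` and `n ≥ 1`:
`Σ_{ℓ,ℓ' ∈ [1,L]} α_ℓ conj(α_ℓ') gcd(nℓ',ℓ)/√(ℓℓ') = Π_{p∈S} Σ_{i,j<3} f_p(i) conj(f_p(j)) p^{min(i,j+v_p(n))}/√(p^i p^j)`.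
[folklore] -/
theorem gcdForm_blockDesign (S : Finset ℕ) (hS : ∀ p ∈ S, p.Prime) (f : ℕ → ℕ → ℂ) (α : ℕ → ℂ)
    (hα : ∀ ℓ, α ℓ = ∑ x ∈ (Fintype.piFinset fun _ : S => Finset.range 3) with
      (∏ i : S, (i : ℕ) ^ x i) = ℓ, ∏ i : S, f i (x i))
    (L : ℕ) (hL : ∏ p ∈ S, p ^ 2 ≤ L) (n : ℕ) (hn : n ≠ 0) :
    (∑ ℓ ∈ Finset.Icc 1 L, ∑ ℓ' ∈ Finset.Icc 1 L, α ℓ * (starRingEnd ℂ) (α ℓ') *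
        (((Nat.gcd (n * ℓ') ℓ : ℕ) : ℝ) : ℂ) / (Real.sqrt ((ℓ : ℝ) * ℓ') : ℂ)) =
      ∏ p ∈ S, ∑ i ∈ Finset.range 3, ∑ j ∈ Finset.range 3, f p i * (starRingEnd ℂ) (f p j) *
        ((p : ℂ) ^ min i (j + n.factorization p) / (Real.sqrt ((p : ℝ) ^ i * (p : ℝ) ^ j) : ℂ)) := by
  classical
  set E := (Fintype.piFinset fun _ : S => Finset.range 3) with hE
  have hmaps : ∀ x ∈ E, (∏ i : S, (i : ℕ) ^ x i) ∈ Finset.Icc 1 L :=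
    fun x hx => mono_mem_Icc S hS L hL x hx
  -- Step 1: unfold the design and collapse the two fibre sums.
  have hconj : ∀ ℓ', (starRingEnd ℂ) (α ℓ') =
      ∑ y ∈ E with (∏ i : S, (i : ℕ) ^ y i) = ℓ', (starRingEnd ℂ) (∏ i : S, f i (y i)) := by
    intro ℓ'
    rw [hα, map_sum]
  have step1 : (∑ ℓ ∈ Finset.Icc 1 L, ∑ ℓ' ∈ Finset.Icc 1 L, α ℓ * (starRingEnd ℂ) (α ℓ') *
      (((Nat.gcd (n * ℓ') ℓ : ℕ) : ℝ) : ℂ) / (Real.sqrt ((ℓ : ℝ) * ℓ') : ℂ)) =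
      ∑ x ∈ E, ∑ y ∈ E, (∏ i : S, f i (x i)) * (starRingEnd ℂ) (∏ i : S, f i (y i)) *
        ((((Nat.gcd (n * ∏ i : S, (i : ℕ) ^ y i) (∏ i : S, (i : ℕ) ^ x i) : ℕ) : ℝ) : ℂ) /
          (Real.sqrt (((∏ i : S, (i : ℕ) ^ x i : ℕ) : ℝ) * ((∏ i : S, (i : ℕ) ^ y i : ℕ) : ℝ)) : ℂ)) := by
    simp_rw [mul_div_assoc, hconj]
    simp_rw [hα]
    exact sum_fiber_mul_sum_fiber E (fun x => ∏ i : S, (i : ℕ) ^ x i) (Finset.Icc 1 L) hmaps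
      (fun x => ∏ i : S, f i (x i)) (fun y => (starRingEnd ℂ) (∏ i : S, f i (y i)))
      (fun ℓ ℓ' => (((Nat.gcd (n * ℓ') ℓ : ℕ) : ℝ) : ℂ) / (Real.sqrt ((ℓ : ℝ) * ℓ') : ℂ))
  rw [step1]
  -- Step 2: each summand is a product over the primes.
  have step2 : ∀ x y : S → ℕ, (∏ i : S, f i (x i)) * (starRingEnd ℂ) (∏ i : S, f i (y i)) *
      ((((Nat.gcd (n * ∏ i : S, (i : ℕ) ^ y i) (∏ i : S, (i : ℕ) ^ x i) : ℕ) : ℝ) : ℂ) /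
        (Real.sqrt (((∏ i : S, (i : ℕ) ^ x i : ℕ) : ℝ) * ((∏ i : S, (i : ℕ) ^ y i : ℕ) : ℝ)) : ℂ)) =
      ∏ i : S, (f i (x i) * (starRingEnd ℂ) (f i (y i)) *
        ((((i : ℕ) : ℂ)) ^ min (x i) (y i + n.factorization i) /
          (Real.sqrt (((i : ℕ) : ℝ) ^ (x i) * ((i : ℕ) : ℝ) ^ (y i)) : ℂ))) := by
    intro x y
    rw [gcdKernel_mono_mono S hS x y n hn, map_prod, Finset.prod_mul_distrib, Finset.prod_mul_distrib]
  simp_rw [step2]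
  -- Step 3: a double sum of products is a product of double sums.
  have step3 : ∀ x : S → ℕ, (∑ y ∈ E, ∏ i : S, (f i (x i) * (starRingEnd ℂ) (f i (y i)) *
      ((((i : ℕ) : ℂ)) ^ min (x i) (y i + n.factorization i) /
        (Real.sqrt (((i : ℕ) : ℝ) ^ (x i) * ((i : ℕ) : ℝ) ^ (y i)) : ℂ)))) =
      ∏ i : S, ∑ b ∈ Finset.range 3, (f i (x i) * (starRingEnd ℂ) (f i b) *
        ((((i : ℕ) : ℂ)) ^ min (x i) (b + n.factorization i) /
          (Real.sqrt (((i : ℕ) : ℝ) ^ (x i) * ((i : ℕ) : ℝ) ^ b) : ℂ))) := by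
    intro x
    rw [hE, Finset.prod_univ_sum]
  simp_rw [step3]
  rw [hE, ← Finset.prod_univ_sum (fun _ : S => Finset.range 3) (fun (i : S) (a : ℕ) =>
    ∑ b ∈ Finset.range 3, (f i a * (starRingEnd ℂ) (f i b) *
      ((((i : ℕ) : ℂ)) ^ min a (b + n.factorization i) /
        (Real.sqrt (((i : ℕ) : ℝ) ^ a * ((i : ℕ) : ℝ) ^ b) : ℂ))))]
  exact Finset.prod_coe_sort S (fun p => ∑ a ∈ Finset.range 3, ∑ b ∈ Finset.range 3,
    f p a * (starRingEnd ℂ) (f p b) *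
      ((p : ℂ) ^ min a (b + n.factorization p) / (Real.sqrt ((p : ℝ) ^ a * (p : ℝ) ^ b) : ℂ)))


/-- **Registered sub-goal `designGcdForm`** (seat-0 anchor of this file, design algebra §1 of the proof of
`stub_designOfTypes`): the gcd form of a block design on `{1,p,p²}^S` factorises over the primes of `S`. [folklore] -/
theorem designGcdForm : ∀ S : Finset ℕ, (∀ p ∈ S, p.Prime) → ∀ f : ℕ → ℕ → ℂ, ∀ α : ℕ → ℂ,
    (∀ ℓ, α ℓ = ∑ x ∈ (Fintype.piFinset fun _ : S => Finset.range 3) with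
      (∏ i : S, (i : ℕ) ^ x i) = ℓ, ∏ i : S, f i (x i)) →
    ∀ L : ℕ, ∏ p ∈ S, p ^ 2 ≤ L → ∀ n : ℕ, n ≠ 0 →
    (∑ ℓ ∈ Finset.Icc 1 L, ∑ ℓ' ∈ Finset.Icc 1 L, α ℓ * (starRingEnd ℂ) (α ℓ') *
        (((Nat.gcd (n * ℓ') ℓ : ℕ) : ℝ) : ℂ) / (Real.sqrt ((ℓ : ℝ) * ℓ') : ℂ)) =
      ∏ p ∈ S, ∑ i ∈ Finset.range 3, ∑ j ∈ Finset.range 3, f p i * (starRingEnd ℂ) (f p j) *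
        ((p : ℂ) ^ min i (j + n.factorization p) / (Real.sqrt ((p : ℝ) ^ i * (p : ℝ) ^ j) : ℂ)) :=
  fun S hS f α hα L hL n hn => gcdForm_blockDesign S hS f α hα L hL n hn

end Design

end Summit.RiemannHypothesis.RiemannHypothesis.Theorems.SignConeConeMagnification
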